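import Summits.NavierStokesRegularity.FunctionalMining.BiaxialEikonalObstruction
import Summits.NavierStokesRegularity.FunctionalMining.TopEigHeatCoerciveGap
import Summits.NavierStokesRegularity.FunctionalMining.TopEigRayleighSpectral
import Literature.Analysis.FunctionSpaces.TorusClassicalNSUniqueness
import HarnessLib

/-!
# FunctionalMining — X-RAY CONSTRAINTS on the flat torus: the longitudinal strain integrates to zero
# along every closed lattice line; for a biaxial strain `m(1 − 3n⊗n)` (fully three-dimensional axis)
# `⟨(k·n)²⟩ = |k|²/3` on every closed `k`-line and the axis meets the magic angle `arccos(1/√3)` there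

Search for candidate a priori estimates; no regularity claim. Cell `pub-nsfunc`, prove seat (gen 20).
Static calculus of smooth fields on the flat torus; nothing about Navier–Stokes dynamics. Third file of
the eikonal-obstruction group (`BiaxialEikonalObstruction`: (4b)(ii) for axes independent of one
coordinate; `BiaxialEikonalSpectrum`: eigenvalue form). Here: the FIRST kernel constraints on a biaxial
strain whose axis may turn in all directions — the "X-ray constraints" noted in `SIEVELD.md` §3.4b (4b)
("⟨(n·a)²⟩ = 1/3 on every closed rational a-line"), which any construction for the open fully
three-dimensional case (§3.4b (4d), pen-and-paper) must satisfy.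

* `fderiv_liftAt`, `hasDerivAt_line`, `hasDerivAt_longitudinal` [folklore]: along the straight line
  `t ↦ x + proj(tK)` the longitudinal component `K·v` has derivative `∑ᵢⱼ KᵢKⱼ∂ⱼvᵢ = Kᵀ S(v) K`
  (`sum_partialDeriv_eq_sum_strain`: the antisymmetric part of `∇v` drops out).
* **`intervalIntegral_longitudinalStrain_eq_zero`** (X-ray identity): for a LATTICE vector `k`
  (`Torus.latticeVec k`, `proj k = 0`) the line closes after time `1`, so `∫₀¹ kᵀS(v)(x + tk)k dt = 0` for
  every smooth `v` and every `x`; `exists_longitudinalStrain_eq_zero` (Rolle): the longitudinal strain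
  vanishes somewhere on every closed lattice line.
* Biaxial axis (`S(v)(y) = m(1 − 3n(y)⊗n(y))`, `m ≠ 0`; `longitudinal_biaxial`: `kᵀSk = m(|k|² − 3(k·n)²)`):
  **`intervalIntegral_axis_longitudinal_sq`**: `∫₀¹ (k·n(x + tk))² dt = |k|²/3` (no measurability of `n`
  is assumed — the integrand is `(|k|² − kᵀSk/m)/3`, continuous in `t`); **`exists_axis_magic_angle`**: a
  point on every closed `k`-line with `3(k·n)² = |k|²`; coordinate circles: `intervalIntegral_axis_coord_sq`
  (`∫₀¹ nⱼ² = 1/3`), `exists_axis_coord_sq_eq_third` (`3nⱼ² = 1` somewhere on every `xⱼ`-circle).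
NOT here: the two-torus constraints `⟨n_a n_b⟩ = δ_ab/3` on rational 2-tori (Fourier/Fubini), Saint-Venant
compatibility of `n⊗n`, any statement about existence in the fully 3-D case; no verdict change.
[ours = assembly; folklore = line calculus]
-/

noncomputable section

namespace Summit.NavierStokesRegularity.FunctionalMining
open Literature.Analysis Literature.Analysis.FunctionSpaces Literature.Analysis.FunctionSpaces.Torus
  Literature.Analysis.FluidPDE MeasureTheory Set intervalIntegral

namespace BiaxialEikonal

variable {d : Type*} [Fintype d] [DecidableEq d]
variable {F : Type*} [NormedAddCommGroup F] [NormedSpace ℝ F]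

/-! ## 1. X-ray constraints: the longitudinal strain integrates to zero along every closed lattice line -/

omit [DecidableEq d] in
/-- The Fréchet derivative of the re-centred lift at ANY point `u` is the torus derivative at `x + proj u`
(translation invariance of `fderiv`; no differentiability needed). [folklore] -/
theorem fderiv_liftAt (f : UnitAddTorus d → F) (x : UnitAddTorus d) (u : EuclideanSpace ℝ d) :
    _root_.fderiv ℝ (liftAt f x) u = Torus.fderiv f (x + proj u) := by
  rw [liftAt_eq_lift_comp_add f (repr x) (proj_repr x)]
  change _root_.fderiv ℝ (fun w => lift f (repr x + w)) u = _
  rw [fderiv_comp_add_left, fderiv_lift, proj_add, proj_repr]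

omit [DecidableEq d] in
/-- Derivative of a smooth field along the straight line `t ↦ x + proj (t·K)`:
`d/dt v(x + tK) = D v(x + tK)[K]`. [folklore] -/
theorem hasDerivAt_line {v : UnitAddTorus d → F} (hv : Torus.IsSmooth v) (x : UnitAddTorus d)
    (K : EuclideanSpace ℝ d) (t : ℝ) :
    HasDerivAt (fun s : ℝ => v (x + proj (s • K))) (Torus.fderiv v (x + proj (t • K)) K) t := by
  have h1 : HasFDerivAt (liftAt v x) (_root_.fderiv ℝ (liftAt v x) (t • K)) (t • K) :=
    (((hv.liftAt x).differentiable (by simp)).differentiableAt).hasFDerivAt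
  have h2 : HasDerivAt (fun s : ℝ => s • K) K t := by
    simpa using (hasDerivAt_id t).smul_const K
  have h := h1.comp_hasDerivAt t h2
  rw [fderiv_liftAt] at h
  exact h

/-- Derivative of the LONGITUDINAL component `K·v(x + tK)` along the line: the longitudinal strain
`Kᵀ S(v) K = ∑ᵢⱼ Kᵢ Kⱼ ∂ⱼvᵢ` at `x + tK` (the antisymmetric part of `∇v` drops out). [folklore] -/
theorem hasDerivAt_longitudinal {v : UnitAddTorus d → EuclideanSpace ℝ d} (hv : Torus.IsSmooth v)
    (x : UnitAddTorus d) (K : EuclideanSpace ℝ d) (t : ℝ) :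
    HasDerivAt (fun s : ℝ => ∑ i, K i * v (x + proj (s • K)) i)
      (∑ i, ∑ j, K i * K j * Torus.partialDeriv j v (x + proj (t • K)) i) t := by
  have hline := hasDerivAt_line hv x K t
  have hcoord : ∀ i, HasDerivAt (fun s : ℝ => v (x + proj (s • K)) i)
      (Torus.fderiv v (x + proj (t • K)) K i) t := fun i =>
    (EuclideanSpace.proj i : EuclideanSpace ℝ d →L[ℝ] ℝ).hasFDerivAt.comp_hasDerivAt t hline
  have hsum : HasDerivAt (fun s : ℝ => ∑ i, K i * v (x + proj (s • K)) i)
      (∑ i, K i * Torus.fderiv v (x + proj (t • K)) K i) t :=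
    HasDerivAt.fun_sum fun i _ => (hcoord i).const_mul (K i)
  have hval : ∀ i, Torus.fderiv v (x + proj (t • K)) K i =
      ∑ j, K j * Torus.partialDeriv j v (x + proj (t • K)) i := by
    intro i
    rw [fderiv_apply_eq_sum_partialDeriv (hv.isContDiff (by simp))]
    simp [Finset.sum_apply]
  refine hsum.congr_deriv (Finset.sum_congr rfl fun i _ => ?_)
  rw [hval i, Finset.mul_sum]
  exact Finset.sum_congr rfl fun j _ => by ring

/-- The longitudinal quadratic form of `∇v` equals that of the strain: `∑ᵢⱼ KᵢKⱼ∂ⱼvᵢ = ∑ᵢⱼ KᵢKⱼSᵢⱼ`.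
[folklore] -/
theorem sum_partialDeriv_eq_sum_strain (v : UnitAddTorus d → EuclideanSpace ℝ d) (y : UnitAddTorus d)
    (K : EuclideanSpace ℝ d) :
    ∑ i, ∑ j, K i * K j * Torus.partialDeriv j v y i = ∑ i, ∑ j, K i * K j * torusStrainMatrix v y i j := by
  have hswap : ∑ i, ∑ j, K i * K j * Torus.partialDeriv j v y i =
      ∑ i, ∑ j, K i * K j * Torus.partialDeriv i v y j := by
    rw [Finset.sum_comm]
    exact Finset.sum_congr rfl fun i _ => Finset.sum_congr rfl fun j _ => by ring
  simp only [torusStrainMatrix_apply]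
  have : ∑ i, ∑ j, K i * K j * ((Torus.partialDeriv j v y i + Torus.partialDeriv i v y j) / 2) =
      (∑ i, ∑ j, K i * K j * Torus.partialDeriv j v y i +
        ∑ i, ∑ j, K i * K j * Torus.partialDeriv i v y j) / 2 := by
    rw [add_div, Finset.sum_div, Finset.sum_div, ← Finset.sum_add_distrib]
    refine Finset.sum_congr rfl fun i _ => ?_
    rw [Finset.sum_div, Finset.sum_div, ← Finset.sum_add_distrib]
    exact Finset.sum_congr rfl fun j _ => by ring
  rw [this, ← hswap]
  ring

/-- Continuity of the longitudinal strain along the line. [folklore] -/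
theorem continuous_longitudinalStrain {v : UnitAddTorus d → EuclideanSpace ℝ d} (hv : Torus.IsSmooth v)
    (x : UnitAddTorus d) (K : EuclideanSpace ℝ d) :
    Continuous fun t : ℝ => ∑ i, ∑ j, K i * K j * torusStrainMatrix v (x + proj (t • K)) i j := by
  have hpath : Continuous fun t : ℝ => x + proj (t • K) :=
    continuous_const.add (continuous_proj.comp (continuous_id.smul continuous_const))
  have hS : ∀ i j, Continuous fun y => torusStrainMatrix v y i j := fun i j => by
    simp only [torusStrainMatrix_apply]
    exact (((hv.partialDeriv j).apply i).continuous.add ((hv.partialDeriv i).apply j).continuous).div_const _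
  exact continuous_finsetSum _ fun i _ => continuous_finsetSum _ fun j _ =>
    continuous_const.mul ((hS i j).comp hpath)

/-- **X-RAY CONSTRAINT (closed lattice lines).** For a smooth field `v` on `T^d`, a lattice vector
`k ∈ ℤ^d` and any base point `x`, the longitudinal strain integrates to zero over the closed line
`t ↦ x + t·k`, `t ∈ [0, 1]`: `∫₀¹ kᵀ S(v)(x + tk) k dt = k·v(x + k) − k·v(x) = 0` (`proj k = 0`).
[folklore; SIEVELD §3.4b (4b), the "X-ray constraints"] -/
theorem intervalIntegral_longitudinalStrain_eq_zero {v : UnitAddTorus d → EuclideanSpace ℝ d}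
    (hv : Torus.IsSmooth v) (k : d → ℤ) (x : UnitAddTorus d) :
    ∫ t in (0 : ℝ)..1, ∑ i, ∑ j, (latticeVec k) i * (latticeVec k) j *
      torusStrainMatrix v (x + proj (t • latticeVec k)) i j = 0 := by
  set K := latticeVec k with hK
  have hderiv : ∀ t ∈ uIcc (0 : ℝ) 1, HasDerivAt (fun s : ℝ => ∑ i, K i * v (x + proj (s • K)) i)
      (∑ i, ∑ j, K i * K j * torusStrainMatrix v (x + proj (t • K)) i j) t := fun t _ => by
    rw [← sum_partialDeriv_eq_sum_strain]
    exact hasDerivAt_longitudinal hv x K t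
  rw [integral_eq_sub_of_hasDerivAt hderiv ((continuous_longitudinalStrain hv x K).intervalIntegrable _ _)]
  simp [hK, proj_latticeVec]

/-- **A zero of the longitudinal strain on every closed lattice line** (Rolle): for smooth `v`, lattice
`k` and every `x` there is `t ∈ (0, 1)` with `kᵀ S(v)(x + tk) k = 0`. [folklore] -/
theorem exists_longitudinalStrain_eq_zero {v : UnitAddTorus d → EuclideanSpace ℝ d}
    (hv : Torus.IsSmooth v) (k : d → ℤ) (x : UnitAddTorus d) :
    ∃ t ∈ Ioo (0 : ℝ) 1, ∑ i, ∑ j, (latticeVec k) i * (latticeVec k) j *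
      torusStrainMatrix v (x + proj (t • latticeVec k)) i j = 0 := by
  set K := latticeVec k with hK
  have hpath : Continuous fun s : ℝ => x + proj (s • K) :=
    continuous_const.add (continuous_proj.comp (continuous_id.smul continuous_const))
  have hcont : Continuous fun s : ℝ => ∑ i, K i * v (x + proj (s • K)) i :=
    continuous_finsetSum _ fun i _ => continuous_const.mul ((hv.apply i).continuous.comp hpath)
  have hends : (∑ i, K i * v (x + proj ((0 : ℝ) • K)) i) = ∑ i, K i * v (x + proj ((1 : ℝ) • K)) i := by
    simp [hK, proj_latticeVec]
  obtain ⟨t, ht, h⟩ := exists_hasDerivAt_eq_zero zero_lt_one hcont.continuousOn hends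
    (fun t _ => hasDerivAt_longitudinal hv x K t)
  exact ⟨t, ht, by rw [← sum_partialDeriv_eq_sum_strain]; exact h⟩

/-! ## 2. X-ray constraints on a biaxial axis field (fully three-dimensional axis) -/

/-- The longitudinal form of a biaxial matrix: `Kᵀ·m(1 − 3n⊗n)·K = m(|K|² − 3(K·n)²)`. [ours] -/
theorem longitudinal_biaxial (m : ℝ) (n K : d → ℝ) :
    ∑ i, ∑ j, K i * K j * (m • (1 - (3 : ℝ) • Matrix.vecMulVec n n) : Matrix d d ℝ) i j =
      m * (∑ i, K i ^ 2 - 3 * (∑ i, K i * n i) ^ 2) := by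
  simp only [Matrix.smul_apply, Matrix.sub_apply, Matrix.one_apply, Matrix.vecMulVec_apply, smul_eq_mul]
  have h1 : ∑ i, ∑ j, K i * K j * (m * ((if i = j then 1 else 0) - 3 * (n i * n j))) =
      m * ∑ i, ∑ j, (K i * K j * (if i = j then 1 else 0) - 3 * (K i * n i * (K j * n j))) := by
    rw [Finset.mul_sum]
    refine Finset.sum_congr rfl fun i _ => ?_
    rw [Finset.mul_sum]
    exact Finset.sum_congr rfl fun j _ => by ring
  rw [h1]
  congr 1
  simp only [Finset.sum_sub_distrib, mul_ite, mul_one, mul_zero, Finset.sum_ite_eq, Finset.mem_univ,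
    if_true, ← Finset.mul_sum, ← Finset.sum_mul, sq]

/-- **X-RAY CONSTRAINT ON THE AXIS OF A BIAXIAL STRAIN** (fully three-dimensional, no symmetry
assumption): if `S(v)(y) = m(1 − 3 n(y)⊗n(y))` with `m ≠ 0`, then along every closed lattice line the
square of the longitudinal component of the axis AVERAGES TO ONE THIRD:
`∫₀¹ (k·n(x + tk))² dt = |k|²/3` (SIEVELD §3.4b (4b): "⟨(n·a)²⟩ = 1/3 on every closed rational a-line").
No measurability of `n` is assumed: the integrand equals `(|k|² − kᵀS k/m)/3`, a continuous function of `t`.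
[ours] -/
theorem intervalIntegral_axis_longitudinal_sq {v : UnitAddTorus d → EuclideanSpace ℝ d}
    (hv : Torus.IsSmooth v) {m : ℝ} (hm : m ≠ 0) {n : UnitAddTorus d → d → ℝ}
    (hS : ∀ y, torusStrainMatrix v y = m • (1 - (3 : ℝ) • Matrix.vecMulVec (n y) (n y)))
    (k : d → ℤ) (x : UnitAddTorus d) :
    ∫ t in (0 : ℝ)..1, (∑ i, (latticeVec k) i * n (x + proj (t • latticeVec k)) i) ^ 2 =
      (∑ i, (latticeVec k) i ^ 2) / 3 := by
  set K := latticeVec k with hK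
  set L : ℝ → ℝ := fun t => ∑ i, ∑ j, K i * K j * torusStrainMatrix v (x + proj (t • K)) i j with hL
  have hLt : ∀ t, L t = m * (∑ i, K i ^ 2 - 3 * (∑ i, K i * n (x + proj (t • K)) i) ^ 2) := by
    intro t
    rw [hL]
    simp only [hS]
    exact longitudinal_biaxial m (n (x + proj (t • K))) K
  have hrepr : ∀ t, (∑ i, K i * n (x + proj (t • K)) i) ^ 2 = ((∑ i, K i ^ 2) - L t / m) / 3 := by
    intro t
    rw [hLt t]
    field_simp
    ring
  simp_rw [hrepr]
  have hLint : IntervalIntegrable L volume 0 1 := (continuous_longitudinalStrain hv x K).intervalIntegrable _ _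
  have hX : ∫ t in (0 : ℝ)..1, L t = 0 := intervalIntegral_longitudinalStrain_eq_zero hv k x
  rw [intervalIntegral.integral_div, intervalIntegral.integral_sub intervalIntegrable_const (hLint.div_const m),
    intervalIntegral.integral_const, intervalIntegral.integral_div, hX]
  simp

/-- **MAGIC-ANGLE POINT ON EVERY CLOSED LATTICE LINE.** For a biaxial strain `m(1 − 3n⊗n)`, `m ≠ 0`, on
every closed lattice line `t ↦ x + tk` there is a point where the longitudinal component of the axis is
EXACTLY `1/√3` of `|k|`: `3(k·n)² = |k|²` — the axis makes the angle `arccos(1/√3)` with the line there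
(Rolle applied to `t ↦ k·v(x + tk)`). In particular the axis is nowhere-along-a-whole-closed-line
orthogonal, or parallel, to a lattice direction. [ours] -/
theorem exists_axis_magic_angle {v : UnitAddTorus d → EuclideanSpace ℝ d} (hv : Torus.IsSmooth v)
    {m : ℝ} (hm : m ≠ 0) {n : UnitAddTorus d → d → ℝ}
    (hS : ∀ y, torusStrainMatrix v y = m • (1 - (3 : ℝ) • Matrix.vecMulVec (n y) (n y)))
    (k : d → ℤ) (x : UnitAddTorus d) :
    ∃ t ∈ Ioo (0 : ℝ) 1, 3 * (∑ i, (latticeVec k) i * n (x + proj (t • latticeVec k)) i) ^ 2 =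
      ∑ i, (latticeVec k) i ^ 2 := by
  obtain ⟨t, ht, h⟩ := exists_longitudinalStrain_eq_zero hv k x
  refine ⟨t, ht, ?_⟩
  rw [hS, longitudinal_biaxial] at h
  have := (mul_eq_zero.mp h).resolve_left hm
  linarith

/-- Coordinate lines: along every closed `xⱼ`-circle the `j`-th axis component has mean square `1/3`,
`∫₀¹ nⱼ(x + t eⱼ)² dt = 1/3` (the case `k = eⱼ`). [ours] -/
theorem intervalIntegral_axis_coord_sq {v : UnitAddTorus d → EuclideanSpace ℝ d} (hv : Torus.IsSmooth v)
    {m : ℝ} (hm : m ≠ 0) {n : UnitAddTorus d → d → ℝ}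
    (hS : ∀ y, torusStrainMatrix v y = m • (1 - (3 : ℝ) • Matrix.vecMulVec (n y) (n y)))
    (j : d) (x : UnitAddTorus d) :
    ∫ t in (0 : ℝ)..1, n (x + proj (t • EuclideanSpace.single j (1 : ℝ))) j ^ 2 = 1 / 3 := by
  have h := intervalIntegral_axis_longitudinal_sq hv hm hS (Pi.single j 1) x
  rw [latticeVec_single] at h
  simpa [PiLp.single_apply, Pi.single_apply, Finset.sum_ite_eq', Finset.mem_univ] using h

/-- … and on every closed `xⱼ`-circle there is a point with `3 nⱼ² = 1` exactly. [ours] -/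
theorem exists_axis_coord_sq_eq_third {v : UnitAddTorus d → EuclideanSpace ℝ d} (hv : Torus.IsSmooth v)
    {m : ℝ} (hm : m ≠ 0) {n : UnitAddTorus d → d → ℝ}
    (hS : ∀ y, torusStrainMatrix v y = m • (1 - (3 : ℝ) • Matrix.vecMulVec (n y) (n y)))
    (j : d) (x : UnitAddTorus d) :
    ∃ t ∈ Ioo (0 : ℝ) 1, 3 * n (x + proj (t • EuclideanSpace.single j (1 : ℝ))) j ^ 2 = 1 := by
  obtain ⟨t, ht, h⟩ := exists_axis_magic_angle hv hm hS (Pi.single j 1) x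
  refine ⟨t, ht, ?_⟩
  rw [latticeVec_single] at h
  simpa [PiLp.single_apply, Pi.single_apply, Finset.sum_ite_eq', Finset.mem_univ] using h

end BiaxialEikonal

end Summit.NavierStokesRegularity.FunctionalMining

end
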